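import Mathlib
import Literature.Barriers.ValiantsHypothesis.AlgebraicNaturalProofs
import Literature.Computability.AlgebraicComplexity.ArithCircuitProofs
import HarnessLib

/-!
# DepthThreeVariableReduction

Topic `Literature/Computability/AlgebraicComplexity`. Named literature fact(s) relocated by the gate from `Summits/ValiantsHypothesis/ValiantsHypothesis/Theorems/BarrierLeverSuccinctHittingSetsForVPSpsk.lean`
(accept-time relocation of `[cite]`d propositions written inline in a Summits proposal; human ruling 2026-08-15).
Sources: SaxenaSeshadhri2012.

* `Literature.Computability.AlgebraicComplexity.SaxenaSeshadhri2012_lemma11`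
-/

namespace Literature.Computability.AlgebraicComplexity

open Literature.Barriers.ValiantsHypothesis Literature.Computability.AlgebraicComplexity MvPolynomial

/-- **Saxena–Seshadhri 2012, Lemma 11 (variable reduction for `ΣΠΣ(k,d,n)` circuits, any field;
the heart of their Theorem 2).** "A depth-3 circuit `C` over a field `F` is of the form
`C(x_1,…,x_n) = Σ_{i=1}^k T_i`, where `T_i` (a multiplication term) is a product of at most `d` linear
polynomials with coefficients in `F`" (§1); `Ψ_β : F[x_1,…,x_n] → F[y_1,…,y_k]` is the linear
homomorphism of the `n × k` Vandermonde matrix `(V_{n,k,β})_{i,j} = β^{ij}`, `x_i ↦ Σ_{j=1}^k β^{ij} y_j`,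
`Ψ_β(α) = α` for `α ∈ F` (§3.2, eq. (2)); Lemma 11 / §4.2: if `C ≠ 0` then for every set `U ⊆ F` of
size `d n k² + 1` there is `β ∈ U` with `Ψ_β(C) ≠ 0` ("The total number of all these bad `β` values
is at most `dnk²`. Therefore, there exists a good `β` in `U`"). Rendered with `0`-based indices
(exponent `(i+1)(j+1)`), terms `T_i = ∏_{j < d_i} ℓ_{ij}`, `d_i ≤ d`, `deg ℓ_{ij} ≤ 1`, and `U` any
finite set of at least `d n k² + 1` elements.
[cite: SaxenaSeshadhri2012, Lemma 11 and Theorem 2] [file Computability/AlgebraicComplexity/DepthThreeVariableReduction] -/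
def SaxenaSeshadhri2012_lemma11 : Prop :=
  ∀ (F : Type) [Field F] (k d n : ℕ) (dd : Fin k → ℕ), (∀ i, dd i ≤ d) →
    ∀ (ℓ : (i : Fin k) → Fin (dd i) → MvPolynomial (Fin n) F),
      (∀ i j, (ℓ i j).totalDegree ≤ 1) →
      (∑ i, ∏ j, ℓ i j) ≠ 0 →
      ∀ U : Finset F, d * n * k ^ 2 + 1 ≤ U.card →
        ∃ β ∈ U, MvPolynomial.aeval
          (fun i : Fin n => ∑ j : Fin k,
            MvPolynomial.C (β ^ ((i.1 + 1) * (j.1 + 1))) * (MvPolynomial.X j : MvPolynomial (Fin k) F))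
          (∑ i, ∏ j, ℓ i j) ≠ 0

end Literature.Computability.AlgebraicComplexity
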